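import Literature.Analysis.FluidPDE.NSLerayRegularised
import HarnessLib

/-!
# Navier–Stokes on `ℝ³`: the existence half of Leray's theorem — global well-posedness of the
  regularised problem with the separation of energy (decomposition of
  `NS.leray_regularised_scheme_exists`)

Trunk: FluidKinetic. `Literature/Analysis/FluidPDE/NSLerayRegularised` reduces Leray's existence
theorem `NS.leray_existence_R3` to two named facts; the limit half `NS.leray_regularised_limit` is
proved in `NSLerayRegularisedLimit*`. This file isolates the content of the remaining half,
`NS.leray_regularised_scheme_exists` (Leray 1934, Ch. V, §§26–27; Ożański–Pooley 2018, Thm. 6.33 and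
Lemma 6.34; Robinson–Rodrigo–Sadowski 2016, Thm. 14.1 and Prop. 14.3), as ONE named fact about a
SINGLE mollifier — **global well-posedness of the Leray-regularised problem with mollified datum,
with the energy equality and the `ε`-uniform tail estimate** (`NS.leray_regularised_wellposed`) — and
proves that it implies `NS.leray_regularised_scheme_exists` (`leray_regularised_scheme_exists_of_wellposed`:
run it along any sequence of bump kernels with radii `→ 0`, `Literature.Analysis.FunctionSpaces.exists_contDiffBump_seq`).

## The printed theorem behind `leray_regularised_wellposed`

For `ε > 0` (here: a bump kernel `χ`, `J = J_χ` the mollification `NS.mollify χ`) and a divergence-free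
datum, the regularised system `∂ₜu − νΔu + ((J u)·∇)u + ∇p = 0`, `div u = 0`, `u(0) = J u₀`
(Leray 1934, (5.1); OP 2018, (6.77)) has a unique global regular solution: local existence,
regularity and the energy equality exactly as for the Navier–Stokes equations (Leray, Ch. III–IV;
OP Thm. 6.22, Cor. 6.16, Thm. 6.17), and globality because `‖J u‖_∞ ≤ C ε^{-3/2}‖u‖₂ ≤ C ε^{-3/2}‖u(0)‖₂`
makes the a priori inequality for `‖u(t)‖_∞` a *linear* Volterra inequality (Leray §26; OP (6.81));
moreover the kinetic energy outside a ball obeys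
`∫_{|x|>R₂}|u(t)|² ≤ ∫_{|x|>R₁}|u(0)|² + C̄(‖u(0)‖₂, t)/(R₂ − R₁)` with `C̄` independent of `ε`
(Leray §27, (5.2)–(5.7); OP Lemma 6.34, `C̄ = C‖u₀‖²√t + C‖u₀‖³t^{1/4}` for `ν = 1`; RRS Prop. 14.3).
The datum `J u₀` of an `L²` weakly divergence-free `u₀` is smooth, divergence free and in every
`H^m ∩ L^∞`, so OP's hypothesis "`u₀ ∈ H¹ ∩ L^∞` divergence free" (p. 138) is met (this is how
Thm. 6.33 is used in the proof of Thm. 6.37, with `u_ε(0) = J_ε u₀`).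

## Contents

* `NS.leray_regularised_wellposed` — **named fact** (the statement above, fields in the shape of
  `NS.IsLerayRegularisedScheme` for one kernel, the tail constant `C̄ ν ‖u₀‖₂ t` quantified before the
  kernel and the datum so that it is `ε`-uniform).
* `NS.leray_regularised_scheme_exists_of_wellposed` — the **assembly** (real proof).
* `NS.leray_existence_R3_of_wellposed_of_limit` — bookkeeping: `leray_regularised_wellposed` and
  `leray_regularised_limit` imply `leray_existence_R3`.

## Mathlib / tree search

No Oseen kernel, Leray regularisation or Volterra-inequality material in Mathlib or the tree beyond
`FluidPDE/MildSolution*`, `FluidPDE/HeatDuhamel*` (heat/Duhamel calculus in the duality formulation)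
and `FluidPDE/NormalisedPressure*` (searched `Oseen`, `Volterra`, `regularis`, `LerayRegular`).

## References

* J. Leray, *Sur le mouvement d'un liquide visqueux emplissant l'espace*, Acta Math. 63 (1934),
  Ch. V §26 (pp. 231–232), §27 (pp. 232–235, (5.2)–(5.7)).
* W. S. Ożański, B. C. Pooley, *Leray's fundamental work on the Navier–Stokes equations*, LMS
  Lecture Note Ser. 452 (CUP 2018), Def. 6.32, Thm. 6.33, Lemma 6.34, (6.77)–(6.85).
* J. C. Robinson, J. L. Rodrigo, W. Sadowski, *The three-dimensional Navier–Stokes equations*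
  (CUP 2016), Thm. 14.1, Prop. 14.3.
-/

noncomputable section

open MeasureTheory TopologicalSpace Set Function Filter Topology ContinuousLinearMap
open scoped InnerProductSpace RealInnerProductSpace ENNReal NNReal Laplacian Convolution

namespace Literature.Analysis.FluidPDE

/-- Local notation for physical space `ℝ³ = EuclideanSpace ℝ (Fin 3)`. -/
local notation "ℝ³" => EuclideanSpace ℝ (Fin 3)

/-- **Global well-posedness of the Leray-regularised problem with the separation of energy**
(Leray 1934, Acta Math. 63, Ch. V, §26, pp. 231–232, and §27, pp. 232–235, (5.2)–(5.7); Ożański–Pooley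
2018, Thm. 6.33 (with Cor. 6.16, Thm. 6.17 for regularity and the energy equality (6.80)) and
Lemma 6.34; Robinson–Rodrigo–Sadowski 2016, Thm. 14.1 (on `𝕋³`) and Prop. 14.3). Let `ν > 0`. There is
a tail constant `C̄ : ℝ → ℝ → ℝ` (of `‖u₀‖₂` and `t`; for `ν = 1` one may take
`C̄(M, t) = C(M²√t + M³t^{1/4})`) such that for every bump kernel `χ` and every weakly
divergence-free `u₀ ∈ L²(ℝ³)` the regularised system
`∂ₜu − νΔu + ((J_χ u)·∇)u + ∇p = 0`, `div u = 0`, `u(0) = J_χ u₀` has a global regular solution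
`U : ℝ → ℝ³ → ℝ³`: jointly `C¹` on `(0, ∞) × ℝ³`, continuous into `L²` on `[0, ∞)`, divergence free
for `t > 0`, satisfying the regularised equations in the weak (pressure-free, divergence-free-tested,
time-sliced) form of `NS.IsLerayRegularisedScheme`, with finite dissipation on every `(0, T)`, the
energy equality `½‖U t‖² + ν∫ₛᵗ∫|∇U|² = ½‖U s‖²` (`0 ≤ s ≤ t`), the datum `U 0 = J_χ u₀`, and the
tail estimate `∫_{‖x‖>R₂}‖U t‖ₑ² ≤ ∫_{‖x‖>R₁}‖U 0‖ₑ² + ofReal (C̄(‖u₀‖₂, t)/(R₂ − R₁))` for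
`0 < R₁ < R₂`, `t ≥ 0`. (Uniqueness, smoothness of all orders and the explicit form of `C̄` are
printed as well but not recorded.) [cite: Leray1934, Ch. V §§26–27, pp. 231–235, (5.1)–(5.7)] [cite: OzanskiPooley2018, Thm. 6.33, Lemma 6.34] [cite: RobinsonRodrigoSadowski2016, Thm. 14.1, Prop. 14.3] -/
def leray_regularised_wellposed : Prop :=
  ∀ (ν : ℝ), 0 < ν → ∃ Cbar : ℝ → ℝ → ℝ,
    ∀ (χ : ContDiffBump (0 : ℝ³)) (u₀ : ℝ³ → ℝ³), MemLp u₀ 2 volume → FluidPDE.IsWeaklyDivFree u₀ →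
      ∃ U : ℝ → ℝ³ → ℝ³,
        ContDiffOn ℝ 1 (uncurry U) (Ioi 0 ×ˢ univ) ∧
        FluidPDE.ContinuousInLpOn (Ici 0) 2 U ∧
        (∀ t, 0 < t → VectorCalculus.IsDivFree (U t)) ∧
        (∀ ψ : ℝ → ℝ³ → ℝ³, FluidPDE.IsSpaceTimeTestOn (⊤ : Opens (ℝ × ℝ³)) ψ →
          (∀ τ, VectorCalculus.IsDivFree (ψ τ)) → ∀ s t, 0 ≤ s → s ≤ t →
            (∫ x, ⟪U t x, ψ t x⟫) - ∫ x, ⟪U s x, ψ s x⟫ =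
              ∫ τ in s..t, ∫ x, (⟪U τ x, FluidPDE.timeDeriv ψ τ x⟫ +
                ⟪U τ x, FluidPDE.convect (mollify χ (U τ)) (ψ τ) x⟫ + ν * ⟪U τ x, Δ (ψ τ) x⟫)) ∧
        (∀ T, ∫⁻ t in Ioo 0 T, ∫⁻ x, ENNReal.ofReal (FluidPDE.frobeniusNormSq (fderiv ℝ (U t) x)) < ∞) ∧
        (∀ s t, 0 ≤ s → s ≤ t →
          VectorCalculus.kineticEnergy (U t) +
              ν * (∫⁻ τ in Ioo s t, ∫⁻ x,
                ENNReal.ofReal (FluidPDE.frobeniusNormSq (fderiv ℝ (U τ) x))).toReal =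
            VectorCalculus.kineticEnergy (U s)) ∧
        (∀ (R₁ R₂ t : ℝ), 0 < R₁ → R₁ < R₂ → 0 ≤ t →
          ∫⁻ x in {x | R₂ < ‖x‖}, ‖U t x‖ₑ ^ 2 ≤
            (∫⁻ x in {x | R₁ < ‖x‖}, ‖U 0 x‖ₑ ^ 2) +
              ENNReal.ofReal (Cbar (eLpNorm u₀ 2 volume).toReal t / (R₂ - R₁))) ∧
        U 0 = mollify χ u₀

/-- **Assembly of the existence half**: global well-posedness of the regularised problems with the
`ε`-uniform tail estimate (`leray_regularised_wellposed`) yields a Leray regularised scheme for every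
datum — run it along a sequence of bump kernels with radii tending to zero
(`Literature.Analysis.FunctionSpaces.exists_contDiffBump_seq`); the tail constant `t ↦ C̄(‖u₀‖₂, t)` does not depend on the kernel.
Real proof. [cite: OzanskiPooley2018, Thm. 6.33, Lemma 6.34 (as used in the proof of Thm. 6.37)] -/
theorem leray_regularised_scheme_exists_of_wellposed (h : leray_regularised_wellposed) :
    leray_regularised_scheme_exists := by
  intro ν hν u₀ hu₀ hdiv
  obtain ⟨Cbar, hC⟩ := h ν hν
  obtain ⟨χ, hχ, -⟩ := FunctionSpaces.exists_contDiffBump_seq (E := ℝ³)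
  choose U hU using fun n => hC (χ n) u₀ hu₀ hdiv
  refine ⟨χ, U, ?_⟩
  exact
    { tendsto_rOut := hχ
      contDiffOn := fun n => (hU n).1
      continuousInL2 := fun n => (hU n).2.1
      divFree := fun n => (hU n).2.2.1
      regularised := fun n => (hU n).2.2.2.1
      dissipation_lt_top := fun n => (hU n).2.2.2.2.1
      energy_eq := fun n => (hU n).2.2.2.2.2.1
      tail := ⟨fun t => Cbar (eLpNorm u₀ 2 volume).toReal t, fun n => (hU n).2.2.2.2.2.2.1⟩
      initial := fun n => (hU n).2.2.2.2.2.2.2 }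

/-- Bookkeeping: Leray's existence theorem on `ℝ³` follows from the global well-posedness of the
regularised problems (`leray_regularised_wellposed`) and the passage to the limit
(`leray_regularised_limit`). Real proof (composition of the two assemblies). [cite: Leray1934, Ch. V §§26–31] -/
theorem leray_existence_R3_of_wellposed_of_limit (h₁ : leray_regularised_wellposed)
    (h₂ : leray_regularised_limit) : leray_existence_R3 :=
  leray_existence_R3_of_regularised (leray_regularised_scheme_exists_of_wellposed h₁) h₂

end Literature.Analysis.FluidPDE
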